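/-
# The cyclic quad-span reduction with the honest (∃-form) hypothesis
(soloist `solo-ValiantsHypothesis-informed`, s11)

`SoloInformedCyclicQuadSpan` reduced `VP ℂ ≠ VNP ℂ` to a bound on free character families of `ℤ/d`
inside a quadratic span of `s` functions that was required UNIFORMLY IN `d` (structure
`SoloCycQuadSpanBound`).  The reduction never needs that much: for each `n` it restricts a cover to
ONE cyclic subgroup of the torus, of any order `d > K h D^n`.  This file records the weakest form the
argument uses,

  (Q_cyc^ev)  for every `s` and every `N` there is SOME modulus `d > N` at which the bound holds

(structure `SoloCycQuadSpanBoundEv`: `bound : ∀ s N, ∃ d, N < d ∧ …`), proves the same chain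
`SoloCycQuadSpanBoundEv K h` + designs + Raz's side conditions ⊢ `VP ℂ ≠ VNP ℂ` / `ValiantsHypothesis`,
and the comparison maps: the uniform structure gives the ∃-form (`SoloCycQuadSpanBound.toEv`), and so
does a bound valid at all sufficiently large PRIMES (`SoloCycQuadSpanBoundEv.ofEventuallyPrime`,
Euclid).  The point (note, §2.8): by Dirichlet rectification and Chevalley's theorem the large-prime
cyclic statement is EQUIVALENT to the curve conjecture (Q*) of `SoloInformedQuadSpanReduction`, so the
∃-form — not the uniform one — is the hypothesis that matches (Q*).  Nothing here asserts any bound;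
non-vacuity is witnessed by the trivial bound `(s+1)(s+2)/2` (`soloInformed_nonempty_cycQuadSpanBoundEv`).

References: R. Raz, Elusive functions and lower bounds for arithmetic circuits, Theory of
Computing 6 (2010), Defs. 1.1, 1.3, §1 result 1, Cor. 1.14 = Cor. 5.8 [cite: Raz2010].
-/
import Mathlib
import Summits.ValiantsHypothesis.ValiantsHypothesis.Theorems.SoloInformedCyclicQuadSpan

noncomputable section

open MvPolynomial Finset

namespace Summit.ValiantsHypothesis.ValiantsHypothesis.Theorems

open Literature.Computability.AlgebraicComplexity

/-! ### The ∃-form structure -/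

/-- **The ∃-form of the cyclic bound** (HYPOTHESIS structure; Conjecture (Q_cyc^ev) of the note
asserts one exists with `Q s = O(s^γ)`, `γ < 3/2`): a bound function `Q` such that for every `s`
there are ARBITRARILY LARGE moduli `d` at which free character families of `ℤ/d` realised inside a
quadratic span of `s` functions have at most `Q s` members. -/
structure SoloCycQuadSpanBoundEv (K h : ℕ) where
  /-- the bound, as a function of the number `s` of functions on `ℤ/d` -/
  Q : ℕ → ℕ
  /-- beyond every `N` there is a modulus `d` at which the bound `Q s` holds -/
  bound : ∀ s N : ℕ, ∃ d : ℕ, N < d ∧ ∀ (v : Fin d → Fin s → ℂ) (E : Finset ℕ), (∀ e ∈ E, e < d) →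
    (∀ c : ℕ → ℤ, (E.filter fun e => c e ≠ 0).card ≤ K → (∀ e, |c e| ≤ h) →
        ((d : ℤ) ∣ ∑ e ∈ E, c e * (e : ℤ)) → ∀ e ∈ E, c e = 0) →
    (∀ e ∈ E, ∃ Γ : MvPolynomial (Fin s) ℂ, Γ.totalDegree ≤ 2 ∧
        ∀ a : Fin d, eval (v a) Γ = soloCycChar d e a) →
      E.card ≤ Q s

/-- The uniform structure of `SoloInformedCyclicQuadSpan` gives the ∃-form (take `d = N + 1`). -/
def SoloCycQuadSpanBound.toEv {K h : ℕ} (B : SoloCycQuadSpanBound K h) :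
    SoloCycQuadSpanBoundEv K h where
  Q := B.Q
  bound := fun s N =>
    ⟨N + 1, Nat.lt_succ_self N, fun v E hE hfree hspan =>
      B.bound (N + 1) s (Nat.succ_pos N) v E hE hfree hspan⟩

/-- **A bound valid at all sufficiently large PRIMES gives the ∃-form** (Euclid:
`Nat.exists_infinite_primes`).  This is the shape in which the note's rectification theorem
delivers the cyclic bound from the curve conjecture (Q*). -/
def SoloCycQuadSpanBoundEv.ofEventuallyPrime {K h : ℕ} (Q : ℕ → ℕ)
    (hQ : ∀ s : ℕ, ∃ d₀ : ℕ, ∀ d : ℕ, d₀ < d → d.Prime →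
      ∀ (v : Fin d → Fin s → ℂ) (E : Finset ℕ), (∀ e ∈ E, e < d) →
        (∀ c : ℕ → ℤ, (E.filter fun e => c e ≠ 0).card ≤ K → (∀ e, |c e| ≤ h) →
            ((d : ℤ) ∣ ∑ e ∈ E, c e * (e : ℤ)) → ∀ e ∈ E, c e = 0) →
        (∀ e ∈ E, ∃ Γ : MvPolynomial (Fin s) ℂ, Γ.totalDegree ≤ 2 ∧
            ∀ a : Fin d, eval (v a) Γ = soloCycChar d e a) →
          E.card ≤ Q s) :
    SoloCycQuadSpanBoundEv K h where
  Q := Q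
  bound := fun s N => by
    classical
    obtain ⟨d₀, hd₀⟩ := hQ s
    obtain ⟨p, hp, hprime⟩ := Nat.exists_infinite_primes (max d₀ N + 1)
    exact ⟨p, by omega, hd₀ p (by omega) hprime⟩

/-! ### The reduction from the ∃-form -/

/-- **∃-form cyclic bound ⇒ elusive design maps.** For a `(K, h)`-design `S` of `m` sets
(`K ≥ 2`, `h ≥ 1`) and `B : SoloCycQuadSpanBoundEv K h` with `B.Q s < m`, the monomial map of `S`
is `(s, 2)`-elusive over `ℂ` (Raz 2010, Def. 1.1): restrict a cover to the cyclic subgroup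
`a ↦ (ζ_d^{a D^r})_r` of the torus, where `d > K h D^n` is a modulus supplied by `B.bound`; there
the exponents are distinct and `(K, h)`-free modulo `d` (`solo_free_image_mod`).
[cite: Raz2010, Def. 1.1] -/
theorem soloInformed_isElusive_designMap_of_cycEv {K h m n : ℕ} (hK : 2 ≤ K) (hh : 1 ≤ h)
    (S : SoloDesign K h m n) (B : SoloCycQuadSpanBoundEv K h) {s : ℕ} (hm : B.Q s < m) :
    IsElusive (soloDesignMap S.S) s 2 := by
  classical
  by_contra hne
  obtain ⟨d, hd, hbound⟩ := B.bound s (K * h * soloBase K h ^ n)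
  obtain ⟨Γ, hΓ, v, hv⟩ := solo_restrict_of_not_isElusive hne (soloCycPoint K h d (n := n))
  have hcard : (univ.image (soloExp K h S.S)).card = m := by
    rw [Finset.card_image_of_injective _ (solo_exp_injective S hK hh), Finset.card_univ,
      Fintype.card_fin]
  have hKh : 0 < K * h := Nat.mul_pos (by omega) (by omega)
  have hE : ∀ e ∈ univ.image (soloExp K h S.S), e < d := by
    intro e he
    obtain ⟨i, -, rfl⟩ := Finset.mem_image.1 he
    have h1 := soloExp_lt hK hh S.S i
    have h2 : soloBase K h ^ n ≤ K * h * soloBase K h ^ n :=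
      Nat.le_mul_of_pos_left (soloBase K h ^ n) hKh
    exact h1.trans_le (h2.trans hd.le)
  have hspan : ∀ e ∈ univ.image (soloExp K h S.S), ∃ Γ' : MvPolynomial (Fin s) ℂ,
      Γ'.totalDegree ≤ 2 ∧ ∀ a : Fin d, eval (v a) Γ' = soloCycChar d e a := by
    intro e he
    obtain ⟨i, -, rfl⟩ := Finset.mem_image.1 he
    exact ⟨Γ i, hΓ i, fun a => by rw [hv a i, solo_eval_designMap_cyc]⟩
  have := hbound v _ hE (solo_free_image_mod hK hh S hd) hspan
  omega

/-- **∃-form cyclic bound + explicit designs ⇒ `VP ℂ ≠ VNP ℂ`** through Raz 2010, §1 result 1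
(tree theorem `Raz2010_result_1_holds`). [cite: Raz2010, §1 result 1, Defs. 1.1, 1.3] -/
theorem soloInformed_vp_ne_vnp_of_cycQuadSpanBoundEv {K h : ℕ} (hK : 2 ≤ K) (hh : 1 ≤ h)
    (B : SoloCycQuadSpanBoundEv K h) {m s : ℕ → ℕ} (S : ∀ n, SoloDesign K h (m n) n)
    (hm : ∀ c : ℕ, ∃ n₀ : ℕ, ∀ n ≥ n₀, n ^ c ≤ m n)
    (hs : ∃ n₀ : ℕ, ∀ n ≥ n₀, m n ^ 9 ≤ s n ^ 10)
    (hQm : ∃ n₀ : ℕ, ∀ n ≥ n₀, B.Q (s n) < m n)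
    (hdef : IsPolyDefinableMap (m := m) (σ := fun n => Fin n) fun n => soloDesignMap (S n).S) :
    VP ℂ ≠ VNP ℂ := by
  refine perNotPComputableComplex_iff_holds.mp ?_
  have hdeg : IsPBounded
      (fun n => Finset.univ.sup fun i : Fin (m n) => (soloDesignMap (S n).S i).totalDegree) :=
    IsPBounded.id.mono fun n => Finset.sup_le fun i _ => solo_totalDegree_designMap_le (S n).S i
  have hel : ∃ n₀ : ℕ, ∀ n ≥ n₀, IsElusive (soloDesignMap (S n).S) (s n) 2 := by
    obtain ⟨n₀, h0⟩ := hQm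
    exact ⟨n₀, fun n hn => soloInformed_isElusive_designMap_of_cycEv hK hh (S n) B (h0 n hn)⟩
  exact Raz2010_result_1_holds ℂ ringChar_complex_ne_two m s (fun n => soloDesignMap (S n).S)
    hm hs hdef hdeg hel

/-- **The same reduction through Raz 2010, Cor. 5.8 (= Cor. 1.14), with `r = r(n)` free** — the
form in which the cyclic bound is needed only with SOME exponent `γ < 3/2`, at SOME modulus beyond
every bound. [cite: Raz2010, Cor. 5.8 = Cor. 1.14, Defs. 1.1, 1.3] -/
theorem soloInformed_vp_ne_vnp_of_cycQuadSpanBoundEv_cor58 {K h : ℕ} (hK : 2 ≤ K) (hh : 1 ≤ h)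
    (B : SoloCycQuadSpanBoundEv K h)
    {r s : ℕ → ℕ} (S : ∀ n, SoloDesign K h (Nat.choose (n + r n - 1) (r n)) n)
    (hpar : ∃ n₀ : ℕ, ∀ n ≥ n₀, 3 ≤ r n ∧ r n ≤ n ∧ n ≤ s n)
    (hgrow : ∀ c : ℕ, ∃ n₀ : ℕ, ∀ n ≥ n₀,
      n ^ c * Nat.choose (n + 2 * r n / 3 - 1) (2 * r n / 3) ≤ s n)
    (hQm : ∃ n₀ : ℕ, ∀ n ≥ n₀, B.Q (s n) < Nat.choose (n + r n - 1) (r n))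
    (hdef : IsPolyDefinableMap (m := fun n => Nat.choose (n + r n - 1) (r n))
      (σ := fun n => Fin n) fun n => soloDesignMap (S n).S) :
    VP ℂ ≠ VNP ℂ := by
  refine perNotPComputableComplex_iff_holds.mp ?_
  have hel : ∃ n₀ : ℕ, ∀ n ≥ n₀, ∃ (G : Type) (_ : Field G) (_ : Algebra ℂ G),
      IsElusive (fun i => MvPolynomial.map (algebraMap ℂ G) (soloDesignMap (S n).S i))
        (s n) 2 := by
    obtain ⟨n₀, h0⟩ := hQm
    refine ⟨n₀, fun n hn => ⟨ℂ, inferInstance, inferInstance, ?_⟩⟩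
    have hid : (fun i => MvPolynomial.map (algebraMap ℂ ℂ) (soloDesignMap (S n).S i))
        = soloDesignMap (S n).S := by
      funext i
      rw [Algebra.algebraMap_self, MvPolynomial.map_id]
    rw [hid]
    exact soloInformed_isElusive_designMap_of_cycEv hK hh (S n) B (h0 n hn)
  exact Raz2010_cor_5_8_holds ℂ ringChar_complex_ne_two r s (fun n => soloDesignMap (S n).S)
    hpar hgrow hdef hel

/-- **Summit form.** The ∃-form cyclic bound (with the Cor. 5.8 parameters and designs) yields the
tree's summit statement `ValiantsHypothesis` (`= VP ℂ ≠ VNP ℂ`). -/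
theorem soloInformed_valiantsHypothesis_of_cycQuadSpanBoundEv_cor58 {K h : ℕ} (hK : 2 ≤ K)
    (hh : 1 ≤ h) (B : SoloCycQuadSpanBoundEv K h)
    {r s : ℕ → ℕ} (S : ∀ n, SoloDesign K h (Nat.choose (n + r n - 1) (r n)) n)
    (hpar : ∃ n₀ : ℕ, ∀ n ≥ n₀, 3 ≤ r n ∧ r n ≤ n ∧ n ≤ s n)
    (hgrow : ∀ c : ℕ, ∃ n₀ : ℕ, ∀ n ≥ n₀,
      n ^ c * Nat.choose (n + 2 * r n / 3 - 1) (2 * r n / 3) ≤ s n)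
    (hQm : ∃ n₀ : ℕ, ∀ n ≥ n₀, B.Q (s n) < Nat.choose (n + r n - 1) (r n))
    (hdef : IsPolyDefinableMap (m := fun n => Nat.choose (n + r n - 1) (r n))
      (σ := fun n => Fin n) fun n => soloDesignMap (S n).S) :
    ValiantsHypothesis :=
  soloInformed_vp_ne_vnp_of_cycQuadSpanBoundEv_cor58 hK hh B S hpar hgrow hQm hdef

/-- **Summit form from a bound at all large primes** — the exact shape of Conjecture (Q_cyc^ev) of the
note (equivalent, by rectification, to the curve conjecture (Q*)). -/
theorem soloInformed_valiantsHypothesis_of_eventuallyPrime_cor58 {K h : ℕ} (hK : 2 ≤ K)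
    (hh : 1 ≤ h) (Q : ℕ → ℕ)
    (hQ : ∀ s : ℕ, ∃ d₀ : ℕ, ∀ d : ℕ, d₀ < d → d.Prime →
      ∀ (v : Fin d → Fin s → ℂ) (E : Finset ℕ), (∀ e ∈ E, e < d) →
        (∀ c : ℕ → ℤ, (E.filter fun e => c e ≠ 0).card ≤ K → (∀ e, |c e| ≤ h) →
            ((d : ℤ) ∣ ∑ e ∈ E, c e * (e : ℤ)) → ∀ e ∈ E, c e = 0) →
        (∀ e ∈ E, ∃ Γ : MvPolynomial (Fin s) ℂ, Γ.totalDegree ≤ 2 ∧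
            ∀ a : Fin d, eval (v a) Γ = soloCycChar d e a) →
          E.card ≤ Q s)
    {r s : ℕ → ℕ} (S : ∀ n, SoloDesign K h (Nat.choose (n + r n - 1) (r n)) n)
    (hpar : ∃ n₀ : ℕ, ∀ n ≥ n₀, 3 ≤ r n ∧ r n ≤ n ∧ n ≤ s n)
    (hgrow : ∀ c : ℕ, ∃ n₀ : ℕ, ∀ n ≥ n₀,
      n ^ c * Nat.choose (n + 2 * r n / 3 - 1) (2 * r n / 3) ≤ s n)
    (hQm : ∃ n₀ : ℕ, ∀ n ≥ n₀, Q (s n) < Nat.choose (n + r n - 1) (r n))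
    (hdef : IsPolyDefinableMap (m := fun n => Nat.choose (n + r n - 1) (r n))
      (σ := fun n => Fin n) fun n => soloDesignMap (S n).S) :
    ValiantsHypothesis :=
  soloInformed_valiantsHypothesis_of_cycQuadSpanBoundEv_cor58 hK hh
    (SoloCycQuadSpanBoundEv.ofEventuallyPrime Q hQ) S hpar hgrow hQm hdef

/-! ### Non-vacuity -/

/-- The ∃-form structure is inhabited, with the trivial bound `(s+1)(s+2)/2` (distinct characters are
linearly independent, `soloInformed_cycQuadSpanBound_trivial`). -/
theorem soloInformed_nonempty_cycQuadSpanBoundEv (K h : ℕ) : Nonempty (SoloCycQuadSpanBoundEv K h) :=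
  ⟨(soloInformed_cycQuadSpanBound_trivial K h).toEv⟩

end Summit.ValiantsHypothesis.ValiantsHypothesis.Theorems

end
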